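import Summits.ValiantsHypothesis.ValiantsHypothesis.Theorems.LacunarySymmetroidMatrixDescartesDoorA26WallBubblingOrderThreeDichotomy

/-!
# `DoorA26` / line `wall_bubbling` — THE FIRST-SHIFT DICHOTOMY FOR EVERY MULTIPLICITY PATTERN (level 1, all orders)

HONEST FRAMING.  Object-search cell `pub-symmetroid`, crux `Theses.LacunarySymmetroid.DoorA26` (stmt-ValiantsHypothesis-19979; OPEN, typed,
never asserted).  W2 seat val-sym-door-p1 g20, file #90; def-free helper for obligation (R) of `Cruxes/DoorA26/Lines/wall_bubbling.lean`.
Imports #81 `…OrderThreeDichotomy` (`iteratedDeriv_firstVariation_linear`; Rockafellar 21.1 from the tree's Literature).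

WHY.  Along the slope `−2` edge (memo `DOOR-A26-P1G20-NEWTON-LIFT.md` §1, #85) a rank-one zero `z` of order `m` is opened by letters `T₁, …, T_h` whose
FIRST shift must satisfy: `c₁^{(k)}(z) = 0` for `k ≤ m − 3` (equalities) and `A·c₁^{(m−2)}(z) < 0` (`A = F^{(m)}(z)/m!`; the coefficient of `σ^{m−2}` of
an even-step polynomial with `m` simple real roots has the sign of `−A`), `c₁ = pol(P,Q₁)`; the higher shifts then solve equalities only.  #81 is the
case `m ≤ 3` (where the first shift is everything).  This file states LEVEL 1 for ALL orders: either a first shift with these jets exists, or a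
GENERALIZED BALANCE — non-negative multipliers on the top rows, not all zero, zero at the simple zeros, annihilating
`Σ_j λ_j F^{(m_j)}(z_j) c₁(w)^{(m_j−2)}(z_j)` for every coordinate shift `w` whose lower jets `c₁(w)^{(k)}(z_j)` (`k ≤ m_j − 3`) all vanish.

WHAT IS HERE.  ★★ `firstShift_feasible_or_balance`.  Nothing here bears on `DoorA26`, `DoorA34`, (W)/(M)/(R), `MatrixDescartes` (18050) or
`VP ≠ VNP`; registers unchanged.

[cite: Rockafellar1970, §21 Thm 21.1] (tree).  [this work] the dichotomy.
-/

set_option linter.dupNamespace false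

namespace Summit.ValiantsHypothesis.ValiantsHypothesis.Theorems.LacunarySymmetroidMatrixDescartes.WallBubbling

open Finset Filter Topology
open Bubbling (TwentyLocus expSum)

/-- ★★ **FIRST-SHIFT DICHOTOMY, all orders.**  `F = det P`; points `z_j` with labels `m_j ≥ 1` (`r ≥ 1` used through `Σ m_j ≥ 20`); `c₁(w) =
pol(P, Q_w)` for the coordinate letters of `w`.  EITHER some `w` has `c₁(w)^{(k)}(z_j) = 0` for all `k + 3 ≤ m_j` and
`F^{(m_j)}(z_j)·c₁(w)^{(m_j−2)}(z_j) < 0` at every `z_j` with `m_j ≥ 2`; OR there are `λ_j ≥ 0`, not all zero, zero where `m_j = 1`, with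
`Σ_j λ_j F^{(m_j)}(z_j) c₁(w)^{(m_j−2)}(z_j) = 0` for every `w` whose lower jets vanish. [this work] -/
theorem firstShift_feasible_or_balance (δ : Fin 6 → ℝ) (S : Fin 6 → Matrix (Fin 2) (Fin 2) ℝ)
    {r : ℕ} (z : Fin r → ℝ) (m : Fin r → ℕ) (hm1 : ∀ j, 1 ≤ m j) (hm : 20 ≤ ∑ j, m j) :
    (∃ w : Fin 6 → Fin 3 → ℝ,
      (∀ j k, k + 3 ≤ m j → iteratedDeriv k (fun t => ((∑ l, Real.exp (δ l * t) • S l)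
          + (∑ l, Real.exp (δ l * t) • (!![w l 0, w l 1; w l 1, w l 2] : Matrix (Fin 2) (Fin 2) ℝ))).det
          - (∑ l, Real.exp (δ l * t) • S l).det
          - (∑ l, Real.exp (δ l * t) • (!![w l 0, w l 1; w l 1, w l 2] : Matrix (Fin 2) (Fin 2) ℝ)).det) (z j) = 0) ∧
      (∀ j, 2 ≤ m j → iteratedDeriv (m j) (fun t => (∑ l, Real.exp (δ l * t) • S l).det) (z j) *
        iteratedDeriv (m j - 2) (fun t => ((∑ l, Real.exp (δ l * t) • S l)
          + (∑ l, Real.exp (δ l * t) • (!![w l 0, w l 1; w l 1, w l 2] : Matrix (Fin 2) (Fin 2) ℝ))).det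
          - (∑ l, Real.exp (δ l * t) • S l).det
          - (∑ l, Real.exp (δ l * t) • (!![w l 0, w l 1; w l 1, w l 2] : Matrix (Fin 2) (Fin 2) ℝ)).det) (z j) < 0)) ∨
    (∃ lam : Fin r → ℝ, (∀ j, 0 ≤ lam j) ∧ lam ≠ 0 ∧ (∀ j, m j = 1 → lam j = 0) ∧
      ∀ w : Fin 6 → Fin 3 → ℝ,
        (∀ j k, k + 3 ≤ m j → iteratedDeriv k (fun t => ((∑ l, Real.exp (δ l * t) • S l)
          + (∑ l, Real.exp (δ l * t) • (!![w l 0, w l 1; w l 1, w l 2] : Matrix (Fin 2) (Fin 2) ℝ))).det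
          - (∑ l, Real.exp (δ l * t) • S l).det
          - (∑ l, Real.exp (δ l * t) • (!![w l 0, w l 1; w l 1, w l 2] : Matrix (Fin 2) (Fin 2) ℝ)).det) (z j) = 0) →
        ∑ j, lam j * (iteratedDeriv (m j) (fun t => (∑ l, Real.exp (δ l * t) • S l).det) (z j) *
          iteratedDeriv (m j - 2) (fun t => ((∑ l, Real.exp (δ l * t) • S l)
            + (∑ l, Real.exp (δ l * t) • (!![w l 0, w l 1; w l 1, w l 2] : Matrix (Fin 2) (Fin 2) ℝ))).det
            - (∑ l, Real.exp (δ l * t) • S l).det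
            - (∑ l, Real.exp (δ l * t) • (!![w l 0, w l 1; w l 1, w l 2] : Matrix (Fin 2) (Fin 2) ℝ)).det) (z j)) = 0) := by
  classical
  set F : ℝ → ℝ := fun t => (∑ l, Real.exp (δ l * t) • S l).det with hF
  let π : (Fin 6 → Fin 3 → ℝ) → ℝ → ℝ := fun w t => ((∑ l, Real.exp (δ l * t) • S l)
      + (∑ l, Real.exp (δ l * t) • (!![w l 0, w l 1; w l 1, w l 2] : Matrix (Fin 2) (Fin 2) ℝ))).det
    - (∑ l, Real.exp (δ l * t) • S l).det
    - (∑ l, Real.exp (δ l * t) • (!![w l 0, w l 1; w l 1, w l 2] : Matrix (Fin 2) (Fin 2) ℝ)).det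
  have hL : ∀ (a b : ℝ) (w w' : Fin 6 → Fin 3 → ℝ) (n : ℕ) (t : ℝ),
      iteratedDeriv n (π (a • w + b • w')) t = a * iteratedDeriv n (π w) t + b * iteratedDeriv n (π w') t :=
    fun a b w w' n t => iteratedDeriv_firstVariation_linear δ S a b w w' n t
  have hneg : ∀ (w : Fin 6 → Fin 3 → ℝ) (n : ℕ) (t : ℝ), iteratedDeriv n (π (-w)) t = -iteratedDeriv n (π w) t := by
    intro w n t
    have h := hL (-1) 0 w w n t
    rw [show ((-1 : ℝ) • w + (0 : ℝ) • w) = -w by simp] at h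
    rw [h]; ring
  have hzero : ∀ (n : ℕ) (t : ℝ), iteratedDeriv n (π ((0 : ℝ) • (0 : Fin 6 → Fin 3 → ℝ) + (0 : ℝ) • 0)) t = 0 := by
    intro n t; rw [hL]; ring
  -- convex data
  let X := Fin 6 → Fin 3 → ℝ
  let C : Set X := {w | ∀ j k, k + 3 ≤ m j → iteratedDeriv k (π w) (z j) = 0}
  let f : Fin r → X → ℝ := fun j w => if m j = 1 then -1 else iteratedDeriv (m j) F (z j) * iteratedDeriv (m j - 2) (π w) (z j)
  have hC : Convex ℝ C := by
    intro x hx y hy a b _ _ _ j k hk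
    show iteratedDeriv k (π (a • x + b • y)) (z j) = 0
    rw [hL, hx j k hk, hy j k hk]; ring
  have hf : ∀ j, ConvexOn ℝ C (f j) := by
    intro j
    refine ⟨hC, fun x _ y _ a b _ _ hab => le_of_eq ?_⟩
    by_cases h1 : m j = 1
    · simp only [f, h1, if_true, smul_eq_mul]
      calc (-1 : ℝ) = -(a + b) := by rw [hab]
        _ = a * -1 + b * -1 := by ring
    · simp only [f, h1, if_false, smul_eq_mul]
      rw [hL]; ring
  have hr : 0 < r := by
    rcases Nat.eq_zero_or_pos r with h | h
    · subst h; simp at hm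
    · exact h
  haveI : Nonempty (Fin r) := ⟨⟨0, hr⟩⟩
  by_cases hfeas : ∃ w ∈ C, ∀ j, f j w < 0
  · obtain ⟨w, hwC, hw⟩ := hfeas
    left
    refine ⟨w, fun j k hk => hwC j k hk, fun j hj => ?_⟩
    have h := hw j
    have h1 : m j ≠ 1 := by omega
    simp only [f, h1, if_false] at h
    exact h
  · obtain ⟨lam, hl0, hlne, hle⟩ :=
      (Literature.Analysis.Convex.ConvexInequalityAlternative.not_exists_forall_lt_iff hC hf).1 hfeas
    right
    have h0C : ((0 : ℝ) • (0 : X) + (0 : ℝ) • (0 : X)) ∈ C := fun j k _ => hzero k (z j)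
    have hsimple : ∀ j, m j = 1 → lam j = 0 := by
      intro j₀ hj₀
      have h := hle _ h0C
      have hterm : ∀ j, lam j * f j ((0 : ℝ) • (0 : X) + (0 : ℝ) • (0 : X)) = -(if m j = 1 then lam j else 0) := by
        intro j
        by_cases h1 : m j = 1
        · simp only [f, h1, if_true]; ring
        · simp only [f, h1, if_false, hzero]; ring
      rw [Finset.sum_congr rfl (fun j _ => hterm j), Finset.sum_neg_distrib] at h
      have hle' : (∑ j, (if m j = 1 then lam j else 0)) ≤ 0 := by linarith
      have hge : (if m j₀ = 1 then lam j₀ else 0) ≤ ∑ j, (if m j = 1 then lam j else 0) :=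
        Finset.single_le_sum (f := fun j => if m j = 1 then lam j else 0)
          (fun j _ => by
            show 0 ≤ (if m j = 1 then lam j else 0)
            split_ifs
            · exact hl0 j
            · exact le_rfl) (Finset.mem_univ j₀)
      rw [if_pos hj₀] at hge
      exact le_antisymm (by linarith) (hl0 j₀)
    refine ⟨lam, hl0, hlne, hsimple, fun w hwC => ?_⟩
    have hwC' : w ∈ C := hwC
    have hnwC : -w ∈ C := by
      intro j k hk
      show iteratedDeriv k (π (-w)) (z j) = 0
      rw [hneg, hwC j k hk, neg_zero]
    have hid : ∀ v : X, ∑ j, lam j * f j v = ∑ j, lam j * (iteratedDeriv (m j) F (z j) * iteratedDeriv (m j - 2) (π v) (z j)) := by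
      intro v
      refine Finset.sum_congr rfl fun j _ => ?_
      by_cases h1 : m j = 1
      · rw [hsimple j h1, zero_mul, zero_mul]
      · simp only [f, h1, if_false]
    have h1 := hle w hwC'
    have h2 := hle (-w) hnwC
    rw [hid] at h1 h2
    have hodd : ∑ j, lam j * (iteratedDeriv (m j) F (z j) * iteratedDeriv (m j - 2) (π (-w)) (z j))
        = -∑ j, lam j * (iteratedDeriv (m j) F (z j) * iteratedDeriv (m j - 2) (π w) (z j)) := by
      rw [← Finset.sum_neg_distrib]
      refine Finset.sum_congr rfl fun j _ => ?_
      rw [hneg]; ring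
    rw [hodd] at h2
    show ∑ j, lam j * (iteratedDeriv (m j) F (z j) * iteratedDeriv (m j - 2) (π w) (z j)) = 0
    linarith

end Summit.ValiantsHypothesis.ValiantsHypothesis.Theorems.LacunarySymmetroidMatrixDescartes.WallBubbling
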